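import Mathlib
import HarnessLib

/-!
# Integration between the zeros; Price's rule for `∫ f(y) sin y dy` over one lobe
# (Davis–Rabinowitz 1984, Sect. 2.10.1)

Davis–Rabinowitz, *Methods of Numerical Integration* (2nd ed., 1984), Sect. 2.10.1 "Integration between the
Zeros", (2.10.1.1)–(2.10.1.4) (the text credits the five-point formula to J. F. Price).

* (2.10.1.1) `∫_0^{2π} f(x) sin nx dx = Σ_{k=0}^{2n-1} ∫_{kπ/n}^{(k+1)π/n} f(x) sin nx dx`, the integrand vanishing
  at the end points of every lobe (`sum_integral_lobes_sin_nat_mul`, `mul_sin_nat_mul_lobe_endpoint`).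
* (2.10.1.2) Price's substitution `I(k) = ∫_0^π g(t) sin kt dt = (1/k) ∫_0^{kπ} g(u/k) sin u du`
  (`integral_mul_sin_mul_eq_inv_mul_integral_comp_div`) and, for an integer `k`, the splitting (2.10.1.3) into
  the lobes `[(j-1)π, jπ]` (`integral_zero_nat_mul_pi_eq_sum_lobes`; lobes are indexed from `0` here:
  lobe `j` of this file is `[jπ, (j+1)π]`, the text's `j+1`).
* (2.10.1.4) Price's five-point formula of interpolatory type
  `(-1)^{j} ∫_{jπ}^{(j+1)π} f(y) sin y dy = H₁[f(jπ) + f((j+1)π)] + H₂[f((j+¼)π) + f((j+¾)π)] + H₃ f((j+½)π) + E`,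
  `H₁ = 1 + 2/π - 16/π²`, `H₂ = -8/π + 32/π²`, `H₃ = 12/π - 32/π²` (`priceH₁`, `priceH₂`, `priceH₃`, `priceRule`):
  the weights are positive and `2H₁ + 2H₂ + H₃ = 2 = ∫_0^π sin`; the formula is EXACT for every real polynomial
  of degree `≤ 3` on every lobe (`priceRule_exact`), and on quartics the error is exactly
  `E = (48 - (17/4)π² - (3/16)π³) · c₄ = priceErrorConst · p⁽⁴⁾` with `priceErrorConst = 2 - (17/96)π² - (1/128)π³`
  (`integral_sub_priceRule_of_natDegree_le_four`), and `0.01002 < priceErrorConst < 0.010023`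
  (`priceErrorConst_bounds`) — the printed constant `.01002 f⁽⁴⁾(ξ)`.  (So the precision is exactly `3`: the rule is
  the two-panel compound of the three-point interpolatory rule for the weight `sin y` on `[0, π/2]`, which is how
  the closed forms of `H₁, H₂, H₃` arise; the `ξ`-form of the remainder for `f ∈ C⁴` is not restated here.)
* The text's remark that on substituting (2.10.1.4) into (2.10.1.3) the `H₁` terms telescope into
  `H₁[g(0) - (-1)^k g(π)]` (`sum_neg_one_pow_mul_endpoints_telescope`), and the resulting composite statement:
  for a cubic `p`, `∫_0^{kπ} p(u) sin u du = Σ_{j<k} (-1)^j · priceRule p j` exactly (`integral_zero_nat_mul_pi_eq_sum_priceRule`).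

Engine (private, folklore): for `deg p ≤ 4`, `u ↦ -p cos u + p' sin u + p'' cos u - p‴ sin u - p⁗ cos u` is a
primitive of `p(u) sin u`, whence the moments `∫_0^π u^i sin u du = 2, π, π² - 4, π³ - 6π, π⁴ - 12π² + 48` (`i ≤ 4`)
from which the closed forms of `H₁, H₂, H₃` and of the quartic defect are read off.

Provenance: engines group, shared numerical engines serving client cells; rigour lives in the verifiers; every
published number belongs to a client cell's ledger, not to the engines group.  Textbook facts only (no client
numbers).
-/

namespace Literature.Analysis.Quadrature

open Real Set MeasureTheory intervalIntegral Finset Polynomial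
open scoped Real Interval

noncomputable section

/-! ### (2.10.1.1): splitting at the zeros of `sin nx` -/

/-- (2.10.1.1): at the end points `x = kπ/n` of the lobes the integrand `f(x) sin nx` vanishes (`n ≠ 0`).
[cite: DavisRabinowitz1984, Sect. 2.10.1 (2.10.1.1)] -/
theorem mul_sin_nat_mul_lobe_endpoint (f : ℝ → ℝ) {n : ℕ} (hn : n ≠ 0) (k : ℕ) :
    f (k * π / n) * Real.sin (n * (k * π / n)) = 0 := by
  have hn' : (n : ℝ) ≠ 0 := Nat.cast_ne_zero.mpr hn
  have : (n : ℝ) * (k * π / n) = k * π := by field_simp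
  rw [this, Real.sin_nat_mul_pi, mul_zero]

/-- (2.10.1.1): `∫_0^{2π} f(x) sin nx dx = Σ_{k<2n} ∫_{kπ/n}^{(k+1)π/n} f(x) sin nx dx` (`n ≠ 0`).
[cite: DavisRabinowitz1984, Sect. 2.10.1 (2.10.1.1)] -/
theorem sum_integral_lobes_sin_nat_mul (f : ℝ → ℝ) {n : ℕ} (hn : n ≠ 0)
    (hf : IntervalIntegrable (fun x => f x * Real.sin (n * x)) volume 0 (2 * π)) :
    ∑ k ∈ Finset.range (2 * n), ∫ x in (k * π / n)..((k + 1 : ℕ) * π / n), f x * Real.sin (n * x) =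
      ∫ x in (0 : ℝ)..2 * π, f x * Real.sin (n * x) := by
  have hn' : (0 : ℝ) < n := Nat.cast_pos.mpr (Nat.pos_of_ne_zero hn)
  have key := intervalIntegral.sum_integral_adjacent_intervals (a := fun k : ℕ => (k : ℝ) * π / n)
    (f := fun x => f x * Real.sin (n * x)) (μ := volume) (n := 2 * n) ?_
  · simp only [Nat.cast_zero, zero_mul, zero_div, Nat.cast_mul, Nat.cast_ofNat] at key
    rw [show (2 : ℝ) * n * π / n = 2 * π by field_simp] at key
    simpa using key
  · intro k hk
    refine hf.mono_set ?_
    have h0 : (0 : ℝ) ≤ k * π / n := by positivity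
    have h1 : ((k + 1 : ℕ) : ℝ) * π / n ≤ 2 * π := by
      rw [div_le_iff₀ hn']
      have : ((k + 1 : ℕ) : ℝ) ≤ 2 * n := by exact_mod_cast hk
      nlinarith [Real.pi_pos]
    have hle : (k : ℝ) * π / n ≤ ((k + 1 : ℕ) : ℝ) * π / n := by
      gcongr
      exact_mod_cast Nat.le_succ k
    rw [uIcc_of_le hle, uIcc_of_le (by positivity : (0 : ℝ) ≤ 2 * π)]
    exact Icc_subset_Icc h0 h1

/-! ### (2.10.1.2)–(2.10.1.3): Price's substitution and the lobes `[jπ, (j+1)π]` -/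

/-- (2.10.1.2): `∫_0^π g(t) sin kt dt = (1/k) ∫_0^{kπ} g(u/k) sin u du` for `k ≠ 0`.
[cite: DavisRabinowitz1984, Sect. 2.10.1 (2.10.1.2)] -/
theorem integral_mul_sin_mul_eq_inv_mul_integral_comp_div (g : ℝ → ℝ) {k : ℝ} (hk : k ≠ 0) :
    ∫ t in (0 : ℝ)..π, g t * Real.sin (k * t) = k⁻¹ * ∫ u in (0 : ℝ)..k * π, g (u / k) * Real.sin u := by
  have h := intervalIntegral.integral_comp_div (fun t => g t * Real.sin (k * t)) hk (a := 0) (b := k * π)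
  simp only [zero_div] at h
  rw [show k * π / k = π by field_simp] at h
  rw [smul_eq_mul] at h
  have h' : ∫ u in (0 : ℝ)..k * π, g (u / k) * Real.sin u = k * ∫ t in (0 : ℝ)..π, g t * Real.sin (k * t) := by
    rw [← h]
    refine intervalIntegral.integral_congr fun u _ => ?_
    simp only [mul_div_cancel₀ _ hk]
  rw [h', ← mul_assoc, inv_mul_cancel₀ hk, one_mul]

/-- (2.10.1.3): for an integer `k`, `∫_0^{kπ} F = Σ_{j<k} ∫_{jπ}^{(j+1)π} F` (lobes indexed from `0`).
[cite: DavisRabinowitz1984, Sect. 2.10.1 (2.10.1.3)] -/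
theorem integral_zero_nat_mul_pi_eq_sum_lobes (F : ℝ → ℝ) (k : ℕ)
    (hF : ∀ j < k, IntervalIntegrable F volume (j * π) ((j + 1 : ℕ) * π)) :
    ∫ u in (0 : ℝ)..k * π, F u = ∑ j ∈ Finset.range k, ∫ u in (j * π)..((j + 1 : ℕ) * π), F u := by
  have key := intervalIntegral.sum_integral_adjacent_intervals (a := fun j : ℕ => (j : ℝ) * π)
    (f := F) (μ := volume) (n := k) hF
  simpa using key.symm

/-- Reduction of lobe `j` to the base lobe: `∫_{jπ}^{(j+1)π} f(y) sin y dy = (-1)^j ∫_0^π f(u + jπ) sin u du`.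
[cite: DavisRabinowitz1984, Sect. 2.10.1 (2.10.1.4)] -/
theorem integral_lobe_mul_sin_eq (f : ℝ → ℝ) (j : ℕ) :
    ∫ y in (j * π)..((j + 1 : ℕ) * π), f y * Real.sin y =
      (-1) ^ j * ∫ u in (0 : ℝ)..π, f (u + j * π) * Real.sin u := by
  have h := intervalIntegral.integral_comp_add_right (fun y => f y * Real.sin y) ((j : ℝ) * π) (a := 0) (b := π)
  simp only [zero_add] at h
  rw [show ((j + 1 : ℕ) : ℝ) * π = π + j * π by push_cast; ring, ← h, ← intervalIntegral.integral_const_mul]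
  refine intervalIntegral.integral_congr fun u _ => ?_
  simp only [Real.sin_add_nat_mul_pi]
  ring

/-! ### (2.10.1.4): Price's rule -/

/-- `H₁ = 1 + 2/π - 16/π² ≈ .01548083`. [cite: DavisRabinowitz1984, Sect. 2.10.1 (2.10.1.4)] -/
def priceH₁ : ℝ := 1 + 2 / π - 16 / π ^ 2

/-- `H₂ = -8/π + 32/π² ≈ .69579879`. [cite: DavisRabinowitz1984, Sect. 2.10.1 (2.10.1.4)] -/
def priceH₂ : ℝ := -8 / π + 32 / π ^ 2

/-- `H₃ = 12/π - 32/π² ≈ .57744076`. [cite: DavisRabinowitz1984, Sect. 2.10.1 (2.10.1.4)] -/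
def priceH₃ : ℝ := 12 / π - 32 / π ^ 2

/-- Price's five-point rule for `(-1)^j ∫_{jπ}^{(j+1)π} f(y) sin y dy` (lobe `j ≥ 0`; the text's lobe `j+1`):
`H₁[f(jπ) + f((j+1)π)] + H₂[f((j+¼)π) + f((j+¾)π)] + H₃ f((j+½)π)`.
[cite: DavisRabinowitz1984, Sect. 2.10.1 (2.10.1.4)] -/
def priceRule (f : ℝ → ℝ) (j : ℕ) : ℝ :=
  priceH₁ * (f (j * π) + f ((j + 1) * π)) + priceH₂ * (f ((j + 1 / 4) * π) + f ((j + 3 / 4) * π)) +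
    priceH₃ * f ((j + 1 / 2) * π)

/-- The error constant of (2.10.1.4) on quartics: `2 - (17/96)π² - (1/128)π³ ≈ .01002`.
[cite: DavisRabinowitz1984, Sect. 2.10.1 (2.10.1.4)] -/
def priceErrorConst : ℝ := 2 - 17 / 96 * π ^ 2 - 1 / 128 * π ^ 3

/-- `2H₁ + 2H₂ + H₃ = 2` (`= ∫_0^π sin`). [cite: DavisRabinowitz1984, Sect. 2.10.1 (2.10.1.4)] -/
theorem priceH_sum : 2 * priceH₁ + 2 * priceH₂ + priceH₃ = 2 := by
  unfold priceH₁ priceH₂ priceH₃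
  ring

/-- `H₁ > 0` (needs `π² + 2π > 16`). [cite: DavisRabinowitz1984, Sect. 2.10.1 (2.10.1.4)] -/
theorem priceH₁_pos : 0 < priceH₁ := by
  unfold priceH₁
  have hπ := Real.pi_gt_d2
  have hπ0 : (0 : ℝ) < π := Real.pi_pos
  have key : (0 : ℝ) < (π ^ 2 + 2 * π - 16) / π ^ 2 := div_pos (by nlinarith) (by positivity)
  convert key using 1
  field_simp

/-- `H₂ > 0` (needs `π < 4`). [cite: DavisRabinowitz1984, Sect. 2.10.1 (2.10.1.4)] -/
theorem priceH₂_pos : 0 < priceH₂ := by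
  unfold priceH₂
  have hπ := Real.pi_lt_four
  have hπ0 : (0 : ℝ) < π := Real.pi_pos
  have key : (0 : ℝ) < 8 * (4 - π) / π ^ 2 := div_pos (by nlinarith) (by positivity)
  convert key using 1
  field_simp
  ring

/-- `H₃ > 0` (needs `π > 8/3`). [cite: DavisRabinowitz1984, Sect. 2.10.1 (2.10.1.4)] -/
theorem priceH₃_pos : 0 < priceH₃ := by
  unfold priceH₃
  have hπ := Real.pi_gt_three
  have hπ0 : (0 : ℝ) < π := Real.pi_pos
  have key : (0 : ℝ) < 4 * (3 * π - 8) / π ^ 2 := div_pos (by nlinarith) (by positivity)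
  convert key using 1
  field_simp
  ring

/-- `.01002 < priceErrorConst < .010023` (the printed constant `.01002`).
[cite: DavisRabinowitz1984, Sect. 2.10.1 (2.10.1.4)] -/
theorem priceErrorConst_bounds : 0.01002 < priceErrorConst ∧ priceErrorConst < 0.010023 := by
  unfold priceErrorConst
  have h1 := Real.pi_gt_d6
  have h2 := Real.pi_lt_d6
  have hπ0 : (0 : ℝ) < π := Real.pi_pos
  have hsq1 : π ^ 2 < 3.141593 ^ 2 := by nlinarith
  have hsq2 : 3.141592 ^ 2 < π ^ 2 := by nlinarith
  have hcu1 : π ^ 3 < 3.141593 ^ 3 := by nlinarith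
  have hcu2 : 3.141592 ^ 3 < π ^ 3 := by nlinarith
  constructor
  · norm_num at hsq1 hcu1 ⊢
    linarith
  · norm_num at hsq2 hcu2 ⊢
    linarith

/-! ### Engine: a primitive of `p(u) sin u` for `deg p ≤ 4`, and the moments on `[0, π]` -/

/-- [folklore] The primitive `-p cos u + p' sin u + p'' cos u - p‴ sin u - p⁗ cos u` of `p(u) sin u`
(`deg p ≤ 4`). -/
private def polySinPrimitive (p : ℝ[X]) (u : ℝ) : ℝ :=
  -(p.eval u * Real.cos u) + p.derivative.eval u * Real.sin u + p.derivative.derivative.eval u * Real.cos u -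
    p.derivative.derivative.derivative.eval u * Real.sin u -
    p.derivative.derivative.derivative.derivative.eval u * Real.cos u

/-- [folklore] For `deg p ≤ 4`, `polySinPrimitive p` is a primitive of `u ↦ p(u) sin u`. -/
private theorem hasDerivAt_polySinPrimitive (p : ℝ[X]) (hp : p.natDegree ≤ 4) (u : ℝ) :
    HasDerivAt (polySinPrimitive p) (p.eval u * Real.sin u) u := by
  have h5 : p.derivative.derivative.derivative.derivative.derivative = 0 := by
    have := Polynomial.iterate_derivative_eq_zero (p := p) (x := 5) (by omega)
    simpa [Function.iterate_succ_apply', Function.iterate_zero] using this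
  have e0 := Polynomial.hasDerivAt p u
  have e1 := Polynomial.hasDerivAt p.derivative u
  have e2 := Polynomial.hasDerivAt p.derivative.derivative u
  have e3 := Polynomial.hasDerivAt p.derivative.derivative.derivative u
  have e4 := Polynomial.hasDerivAt p.derivative.derivative.derivative.derivative u
  rw [h5, eval_zero] at e4
  have hc := Real.hasDerivAt_cos u
  have hs := Real.hasDerivAt_sin u
  have key : HasDerivAt (polySinPrimitive p)
      (-(p.derivative.eval u * Real.cos u + p.eval u * -Real.sin u) +
        (p.derivative.derivative.eval u * Real.sin u + p.derivative.eval u * Real.cos u) +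
        (p.derivative.derivative.derivative.eval u * Real.cos u + p.derivative.derivative.eval u * -Real.sin u) -
        (p.derivative.derivative.derivative.derivative.eval u * Real.sin u +
          p.derivative.derivative.derivative.eval u * Real.cos u) -
        (0 * Real.cos u + p.derivative.derivative.derivative.derivative.eval u * -Real.sin u)) u :=
    ((((e0.fun_mul hc).fun_neg.fun_add (e1.fun_mul hs)).fun_add (e2.fun_mul hc)).fun_sub (e3.fun_mul hs)).fun_sub
      (e4.fun_mul hc)
  refine key.congr_deriv ?_
  ring

/-- [folklore] `∫_a^b p(u) sin u du = polySinPrimitive p b - polySinPrimitive p a` for `deg p ≤ 4`. -/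
private theorem integral_poly_mul_sin_eq (p : ℝ[X]) (hp : p.natDegree ≤ 4) (a b : ℝ) :
    ∫ u in a..b, p.eval u * Real.sin u = polySinPrimitive p b - polySinPrimitive p a := by
  apply intervalIntegral.integral_eq_sub_of_hasDerivAt
  · intro u _
    exact hasDerivAt_polySinPrimitive p hp u
  · exact ((Polynomial.continuous p).mul Real.continuous_sin).intervalIntegrable _ _

/-- [folklore] Moment `∫_0^π u⁰ sin u du = 2`. -/
private theorem integral_pow_zero_mul_sin : ∫ u in (0 : ℝ)..π, u ^ 0 * Real.sin u = 2 := by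
  have h := integral_poly_mul_sin_eq (X ^ 0 : ℝ[X]) (by simp) 0 π
  simp only [eval_pow, eval_X] at h
  rw [h]
  simp [polySinPrimitive, Real.cos_pi, Real.sin_pi]
  norm_num

/-- [folklore] Moment `∫_0^π u sin u du = π`. -/
private theorem integral_pow_one_mul_sin : ∫ u in (0 : ℝ)..π, u ^ 1 * Real.sin u = π := by
  have h := integral_poly_mul_sin_eq (X ^ 1 : ℝ[X]) (by simp) 0 π
  simp only [eval_pow, eval_X] at h
  rw [h]
  simp [polySinPrimitive, Real.cos_pi, Real.sin_pi]

/-- [folklore] Moment `∫_0^π u² sin u du = π² - 4`. -/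
private theorem integral_pow_two_mul_sin : ∫ u in (0 : ℝ)..π, u ^ 2 * Real.sin u = π ^ 2 - 4 := by
  have h := integral_poly_mul_sin_eq (X ^ 2 : ℝ[X]) (by simp) 0 π
  simp only [eval_pow, eval_X] at h
  rw [h]
  simp [polySinPrimitive, Real.cos_pi, Real.sin_pi]
  ring

/-- [folklore] Moment `∫_0^π u³ sin u du = π³ - 6π`. -/
private theorem integral_pow_three_mul_sin : ∫ u in (0 : ℝ)..π, u ^ 3 * Real.sin u = π ^ 3 - 6 * π := by
  have h := integral_poly_mul_sin_eq (X ^ 3 : ℝ[X]) (by simp) 0 π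
  simp only [eval_pow, eval_X] at h
  rw [h]
  simp [polySinPrimitive, Real.cos_pi, Real.sin_pi]
  ring

/-- [folklore] Moment `∫_0^π u⁴ sin u du = π⁴ - 12π² + 48`. -/
private theorem integral_pow_four_mul_sin : ∫ u in (0 : ℝ)..π, u ^ 4 * Real.sin u = π ^ 4 - 12 * π ^ 2 + 48 := by
  have h := integral_poly_mul_sin_eq (X ^ 4 : ℝ[X]) (by simp) 0 π
  simp only [eval_pow, eval_X] at h
  rw [h]
  simp [polySinPrimitive, Real.cos_pi, Real.sin_pi]
  ring

/-- [folklore] `∫_0^π p(u) sin u du = Σ_{i<n} cᵢ ∫_0^π u^i sin u du` for `deg p < n`. -/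
private theorem integral_poly_mul_sin_eq_sum (p : ℝ[X]) {n : ℕ} (hn : p.natDegree < n) :
    ∫ u in (0 : ℝ)..π, p.eval u * Real.sin u =
      ∑ i ∈ Finset.range n, p.coeff i * ∫ u in (0 : ℝ)..π, u ^ i * Real.sin u := by
  simp_rw [eval_eq_sum_range' hn, Finset.sum_mul]
  rw [intervalIntegral.integral_finsetSum fun i _ => ?_]
  · refine Finset.sum_congr rfl fun i _ => ?_
    rw [← intervalIntegral.integral_const_mul]
    refine intervalIntegral.integral_congr fun u _ => ?_
    ring
  · exact ((continuous_const.mul (continuous_pow i)).mul Real.continuous_sin).intervalIntegrable _ _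

/-! ### Exactness of Price's rule for cubics and the quartic defect -/

/-- Price's rule is exact on the base lobe for every real polynomial of degree `≤ 3`:
`∫_0^π p(u) sin u du = H₁[p(0) + p(π)] + H₂[p(π/4) + p(3π/4)] + H₃ p(π/2)`.
[cite: DavisRabinowitz1984, Sect. 2.10.1 (2.10.1.4)] -/
theorem priceRule_exact_zero (p : ℝ[X]) (hp : p.natDegree ≤ 3) :
    ∫ u in (0 : ℝ)..π, p.eval u * Real.sin u = priceRule (fun u => p.eval u) 0 := by
  have hn : p.natDegree < 4 := by omega
  rw [integral_poly_mul_sin_eq_sum p hn, priceRule]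
  simp only [eval_eq_sum_range' hn, Finset.sum_range_succ, Finset.sum_range_zero, zero_add,
    integral_pow_zero_mul_sin, integral_pow_one_mul_sin, integral_pow_two_mul_sin, integral_pow_three_mul_sin]
  simp only [priceH₁, priceH₂, priceH₃, Nat.cast_zero, zero_mul, zero_add]
  have hπ : (π : ℝ) ≠ 0 := Real.pi_ne_zero
  field_simp
  ring

/-- The quartic defect on the base lobe: for `deg p ≤ 4`,
`∫_0^π p(u) sin u du - priceRule p 0 = (48 - (17/4)π² - (3/16)π³) c₄ = priceErrorConst · (24 c₄) = priceErrorConst · p⁗`.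
[cite: DavisRabinowitz1984, Sect. 2.10.1 (2.10.1.4)] -/
theorem integral_sub_priceRule_zero_of_natDegree_le_four (p : ℝ[X]) (hp : p.natDegree ≤ 4) :
    (∫ u in (0 : ℝ)..π, p.eval u * Real.sin u) - priceRule (fun u => p.eval u) 0 =
      priceErrorConst * (24 * p.coeff 4) := by
  have hn : p.natDegree < 5 := by omega
  rw [integral_poly_mul_sin_eq_sum p hn, priceRule]
  simp only [eval_eq_sum_range' hn, Finset.sum_range_succ, Finset.sum_range_zero, zero_add,
    integral_pow_zero_mul_sin, integral_pow_one_mul_sin, integral_pow_two_mul_sin, integral_pow_three_mul_sin,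
    integral_pow_four_mul_sin]
  simp only [priceH₁, priceH₂, priceH₃, priceErrorConst, Nat.cast_zero, zero_mul, zero_add]
  have hπ : (π : ℝ) ≠ 0 := Real.pi_ne_zero
  field_simp
  ring

/-- [folklore] Shifting a polynomial: `p(u + a) = (p.comp (X + C a))(u)` and the degree does not grow. -/
private theorem natDegree_comp_X_add_C_le (p : ℝ[X]) (a : ℝ) : (p.comp (X + C a)).natDegree ≤ p.natDegree := by
  calc (p.comp (X + C a)).natDegree ≤ p.natDegree * (X + C a).natDegree := natDegree_comp_le
    _ = p.natDegree := by rw [natDegree_X_add_C, mul_one]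

/-- [folklore] The shifted integrand as the composed polynomial. -/
private theorem integral_shift_eq_integral_comp (p : ℝ[X]) (a : ℝ) :
    ∫ u in (0 : ℝ)..π, p.eval (u + a) * Real.sin u = ∫ u in (0 : ℝ)..π, (p.comp (X + C a)).eval u * Real.sin u := by
  refine intervalIntegral.integral_congr fun u _ => ?_
  simp only [eval_comp, eval_add, eval_X, eval_C]

/-- [folklore] Price's rule on lobe `j` of `p` is Price's rule on lobe `0` of the shifted polynomial. -/
private theorem priceRule_shift_eq_priceRule_comp (p : ℝ[X]) (j : ℕ) :
    priceRule (fun y => p.eval y) j = priceRule (fun u => (p.comp (X + C ((j : ℝ) * π))).eval u) 0 := by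
  simp only [priceRule, eval_comp, eval_add, eval_X, eval_C, Nat.cast_zero, zero_mul, zero_add]
  ring_nf

/-- [folklore] The top coefficient is invariant under the shift `X ↦ X + a` (`deg p ≤ 4`). -/
private theorem coeff_four_comp_X_add_C (p : ℝ[X]) (hp : p.natDegree ≤ 4) (a : ℝ) :
    (p.comp (X + C a)).coeff 4 = p.coeff 4 := by
  rcases Nat.lt_or_ge p.natDegree 4 with h | h
  · rw [coeff_eq_zero_of_natDegree_lt ((natDegree_comp_X_add_C_le p a).trans_lt h),
      coeff_eq_zero_of_natDegree_lt h]
  · have h4 : p.natDegree = 4 := le_antisymm hp h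
    have key := coeff_comp_degree_mul_degree (p := p) (q := X + C a) (by rw [natDegree_X_add_C]; norm_num)
    rw [natDegree_X_add_C, h4, mul_one, leadingCoeff_X_add_C, one_pow, mul_one] at key
    rw [key, leadingCoeff, h4]

/-- [folklore] Iterated derivatives of a polynomial function are the polynomial's iterated derivatives. -/
private theorem iterate_deriv_polynomial_eval (p : ℝ[X]) (n : ℕ) :
    deriv^[n] (fun y => p.eval y) = fun y => (derivative^[n] p).eval y := by
  induction n generalizing p with
  | zero => rfl
  | succ n ih =>
    rw [Function.iterate_succ_apply, Function.iterate_succ_apply]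
    have : deriv (fun y => p.eval y) = fun y => p.derivative.eval y := funext fun y => Polynomial.deriv p
    rw [this, ih]

/-- (2.10.1.4) on every lobe: for every real polynomial `p` of degree `≤ 3` and every `j ≥ 0`,
`(-1)^j ∫_{jπ}^{(j+1)π} p(y) sin y dy = H₁[p(jπ) + p((j+1)π)] + H₂[p((j+¼)π) + p((j+¾)π)] + H₃ p((j+½)π)`.
[cite: DavisRabinowitz1984, Sect. 2.10.1 (2.10.1.4)] -/
theorem priceRule_exact (p : ℝ[X]) (hp : p.natDegree ≤ 3) (j : ℕ) :
    (-1) ^ j * ∫ y in (j * π)..((j + 1 : ℕ) * π), p.eval y * Real.sin y = priceRule (fun y => p.eval y) j := by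
  rw [integral_lobe_mul_sin_eq, ← mul_assoc, ← mul_pow, neg_one_mul, neg_neg, one_pow, one_mul]
  have hq : (p.comp (X + C ((j : ℝ) * π))).natDegree ≤ 3 := (natDegree_comp_X_add_C_le p _).trans hp
  rw [integral_shift_eq_integral_comp, priceRule_shift_eq_priceRule_comp, priceRule_exact_zero _ hq]

/-- (2.10.1.4), quartic defect on every lobe: for `deg p ≤ 4`,
`(-1)^j ∫_{jπ}^{(j+1)π} p(y) sin y dy - priceRule p j = priceErrorConst · (24 c₄)` (`= priceErrorConst · p⁗`,
a constant), so the precision of Price's rule is exactly `3`. [cite: DavisRabinowitz1984, Sect. 2.10.1 (2.10.1.4)] -/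
theorem integral_sub_priceRule_of_natDegree_le_four (p : ℝ[X]) (hp : p.natDegree ≤ 4) (j : ℕ) :
    (-1) ^ j * (∫ y in (j * π)..((j + 1 : ℕ) * π), p.eval y * Real.sin y) - priceRule (fun y => p.eval y) j =
      priceErrorConst * (24 * p.coeff 4) := by
  rw [integral_lobe_mul_sin_eq, ← mul_assoc, ← mul_pow, neg_one_mul, neg_neg, one_pow, one_mul]
  have hq : (p.comp (X + C ((j : ℝ) * π))).natDegree ≤ 4 := (natDegree_comp_X_add_C_le p _).trans hp
  rw [integral_shift_eq_integral_comp, priceRule_shift_eq_priceRule_comp,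
    integral_sub_priceRule_zero_of_natDegree_le_four _ hq, coeff_four_comp_X_add_C p hp]

/-- The iterated fourth derivative of a quartic is the constant `24 c₄`, identifying the defect above with
`priceErrorConst · p⁗(ξ)` for any `ξ`. [cite: DavisRabinowitz1984, Sect. 2.10.1 (2.10.1.4)] -/
theorem iteratedDeriv_four_eval_of_natDegree_le_four (p : ℝ[X]) (hp : p.natDegree ≤ 4) (ξ : ℝ) :
    iteratedDeriv 4 (fun y => p.eval y) ξ = 24 * p.coeff 4 := by
  rw [iteratedDeriv_eq_iterate, iterate_deriv_polynomial_eval]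
  have hd : (derivative^[4] p).natDegree ≤ 0 := by
    have := natDegree_iterate_derivative p 4
    omega
  have hc : (derivative^[4] p).coeff 0 = 24 * p.coeff 4 := by
    rw [coeff_iterate_derivative, zero_add, nsmul_eq_mul]
    norm_num [Nat.descFactorial]
  show (derivative^[4] p).eval ξ = 24 * p.coeff 4
  rw [eq_C_of_natDegree_le_zero hd, eval_C, hc]

/-! ### The telescoping of the `H₁` terms and the composite rule -/

/-- The text's remark after (2.10.1.4): summed over the lobes with the signs `(-1)^j`, the end-point terms telescope:
`Σ_{j<k} (-1)^j [f(jπ) + f((j+1)π)] = f(0) - (-1)^k f(kπ)`.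
[cite: DavisRabinowitz1984, Sect. 2.10.1 (2.10.1.4)] -/
theorem sum_neg_one_pow_mul_endpoints_telescope (f : ℝ → ℝ) (k : ℕ) :
    ∑ j ∈ Finset.range k, (-1 : ℝ) ^ j * (f (j * π) + f ((j + 1) * π)) = f 0 - (-1) ^ k * f (k * π) := by
  induction k with
  | zero => simp
  | succ k ih =>
    rw [Finset.sum_range_succ, ih, pow_succ]
    push_cast
    ring

/-- Composite form of Price's method for a cubic: `∫_0^{kπ} p(u) sin u du = Σ_{j<k} (-1)^j · priceRule p j`
(every lobe exact).  [cite: DavisRabinowitz1984, Sect. 2.10.1 (2.10.1.3)] -/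
theorem integral_zero_nat_mul_pi_eq_sum_priceRule (p : ℝ[X]) (hp : p.natDegree ≤ 3) (k : ℕ) :
    ∫ u in (0 : ℝ)..k * π, p.eval u * Real.sin u =
      ∑ j ∈ Finset.range k, (-1 : ℝ) ^ j * priceRule (fun y => p.eval y) j := by
  rw [integral_zero_nat_mul_pi_eq_sum_lobes (fun u => p.eval u * Real.sin u) k fun j _ =>
    ((Polynomial.continuous p).mul Real.continuous_sin).intervalIntegrable _ _]
  refine Finset.sum_congr rfl fun j _ => ?_
  rw [← priceRule_exact p hp j, ← mul_assoc, ← mul_pow, neg_one_mul, neg_neg, one_pow, one_mul]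

end

end Literature.Analysis.Quadrature
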